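import Summits.CriticalPhenomena.PercolationContinuityZ3.Theorems.PercNearOneGluingNoHeavyLowerTailThreePointVarianceLeFive
import HarnessLib

/-!
# The SET form of the three-point variance row, `|W| = 2`: `Var(1_{a↔b}) ≤ P(1_{a↔b} ≠ 1_{W ↔ {a,b}})` for `W = {c,d}`, on every weighted graph with at most five vertices

Support file for crux `stmt-CriticalPhenomena-4575` (`NoHeavyLowerTail`), seat `prim-l12-p1` gen 16 (`--supports stmt-CriticalPhenomena-4575`;
COMPUTATIONAL: two `checkC` evaluations use `native_decide`).  Memo `run/shared/lean/prim/prim-l12/FROM-prim-l12-p1-g16-SHARP-3PT.md` §5.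

Bond percolation `μ = prodBernoulli w` with arbitrary edge weights on `Fin n`.  Gen 15 landed the three-point variance row
`(3PT)  P(a↔b)·P(a↮b) ≤ P(exactly one link among a,b,c)` for `n ≤ 5` (`ThreePointVariance.threePointVariance_le_five`), whose right side is
`P(1_{a↔b} ≠ 1_{c↔a ∨ c↔b})`: the indicator of `a ↔ b` is at `L¹`-distance at least `Var(1_{a↔b})` from the "contact indicator" of the vertex `c`.
THE NEW ROW (conjectured for every finite graph and every vertex set `W`, memo §5, conjecture `(3PT-W)`) replaces the vertex `c` by a SET `W`:

  `(3PT-W)   P(a↔b)·P(a↮b) ≤ P(a↔b, W ↮ {a,b}) + P(a↮b, W ↔ {a,b})`,   `W ↔ {a,b}` := some vertex of `W` is connected to `a` or to `b`.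

THIS FILE proves the case `W = {c,d}` (so, with gen 15, every `|W| ≤ 2`... and hence every `W` avoiding `a,b` when `n ≤ 4`) for every `n ≤ 5`, every weight vector and
all pairwise distinct `a b c d`, by prim-bnk-1's generic packaging `CombRows.quad_cval_le_five`: the three-term family `setTerms` is relabelling-equivariant (`rfl`)
and passes prim-cert-2's three-copy comb checker `checkC` at the standard quadruple of `K₄` and `K₅` (a quadratic row with `pTrue` third factors is three-copy
comb positive iff two-copy comb positive; the fibre counts are tight (minimum `0`) on both).  Nothing is claimed here beyond five vertices.

Main results: `set_cval_le_five` (term form), `threePointVarianceTwoSet_le_five` (the displayed inequality in `openConn` notation).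
-/

namespace Summit.CriticalPhenomena.PercolationContinuityZ3.Theorems.ThreePointVarianceSet

open Finset MeasureTheory OneCutCert CovTransferCert E3GroupSepCert CombRows ThreePointVariance
open scoped BigOperators
open Literature.Probability.Percolation Literature.Probability.LatticeModels

variable {n : ℕ}

/-- The event `a ↔ b` while neither `c` nor `d` touches `{a,b}`. [this work] -/
def pD1 (a b c d : Fin n) : CRel n → Bool := fun r => r a b && !(r a c) && !(r b c) && !(r a d) && !(r b d)
/-- The event `a ↮ b` while `c` or `d` touches `{a,b}`. [this work] -/
def pD2 (a b c d : Fin n) : CRel n → Bool := fun r => !(r a b) && (r a c || r b c || r a d || r b d)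

/-- The three signed terms of `(3PT-W)`, `W = {c,d}` (right side minus left side; unused factors `pTrue`):
`P(ab, W↮ab)·1·1 + P(a↮b, W↔ab)·1·1 − P(a↔b)·P(a↮b)·1`. [this work] -/
def setTerms (n : ℕ) (x : Quad n) : List (CTerm n) :=
  let a := x.1
  let b := x.2.1
  let c := x.2.2.1
  let d := x.2.2.2
  [((1 : ℤ), pD1 a b c d, pTrue, pTrue), ((1 : ℤ), pD2 a b c d, pTrue, pTrue), ((-1 : ℤ), pAB a b, pNAB a b, pTrue)]

/-- The family commutes with vertex relabellings. [this work] -/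
theorem setTerms_equivariant : QuadEquivariant setTerms := by
  intro n τ x
  obtain ⟨a, b, c, d⟩ := x
  rfl

/-- `K₄` check (base `2^23`). [this work] -/
theorem checkSet4 : checkC 4 23 (setTerms 4 (quad₀ 4 le_rfl)) = true := by native_decide

/-- `K₅` check (base `2^35`). [this work] -/
theorem checkSet5 : checkC 5 35 (setTerms 5 (quad₀ 5 (by norm_num))) = true := by native_decide

/-- **`(3PT-W)`, `W = {c,d}` (term form) on every weighted graph with at most five vertices.** [this work] -/
theorem set_cval_le_five : ∀ n ≤ 5, ∀ (w : Sym2 (Fin n) → unitInterval) (a b c d : Fin n),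
    a ≠ b → a ≠ c → a ≠ d → b ≠ c → b ≠ d → c ≠ d → 0 ≤ cval w (setTerms n (a, b, c, d)) :=
  quad_cval_le_five setTerms_equivariant checkSet4 checkSet5

/-! ## The two new predicates as connection events -/

section cells
variable (a b c d : Fin n)

/-- `a ↔ b, W ↮ {a,b}` in `openConn` notation. [this work] -/
theorem connEvent_pD1 : connEvent (pD1 a b c d) =
    openConn a b ∩ (openConn a c)ᶜ ∩ (openConn b c)ᶜ ∩ (openConn a d)ᶜ ∩ (openConn b d)ᶜ := by
  ext ω
  simp only [connEvent, pD1, Set.mem_setOf_eq, Set.mem_inter_iff, Set.mem_compl_iff, Bool.and_eq_true, Bool.not_eq_true',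
    decide_eq_true_eq, decide_eq_false_iff_not]
/-- `a ↮ b, W ↔ {a,b}` in `openConn` notation. [this work] -/
theorem connEvent_pD2 : connEvent (pD2 a b c d) =
    (openConn a b)ᶜ ∩ (openConn a c ∪ openConn b c ∪ openConn a d ∪ openConn b d) := by
  ext ω
  simp only [connEvent, pD2, Set.mem_setOf_eq, Set.mem_inter_iff, Set.mem_compl_iff, Set.mem_union, Bool.and_eq_true,
    Bool.or_eq_true, Bool.not_eq_true', decide_eq_true_eq, decide_eq_false_iff_not, or_assoc]

end cells

/-- **The set form of the three-point variance row for `W = {c,d}` on every weighted graph with at most five vertices**: for `n ≤ 5`, every `w` and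
all pairwise distinct `a b c d : Fin n`,
`P(a↔b)·P(a↮b) ≤ P(a↔b, c↮a, c↮b, d↮a, d↮b) + P(a↮b, (c↔a ∨ c↔b ∨ d↔a ∨ d↔b))`. [this work] -/
theorem threePointVarianceTwoSet_le_five (hn : n ≤ 5) (w : Sym2 (Fin n) → unitInterval) (a b c d : Fin n) (hab : a ≠ b) (hac : a ≠ c)
    (had : a ≠ d) (hbc : b ≠ c) (hbd : b ≠ d) (hcd : c ≠ d) :
    (prodBernoulli w).real (openConn a b) * (prodBernoulli w).real (openConn a b)ᶜ ≤
      (prodBernoulli w).real (openConn a b ∩ (openConn a c)ᶜ ∩ (openConn b c)ᶜ ∩ (openConn a d)ᶜ ∩ (openConn b d)ᶜ) +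
        (prodBernoulli w).real ((openConn a b)ᶜ ∩ (openConn a c ∪ openConn b c ∪ openConn a d ∪ openConn b d)) := by
  have h := set_cval_le_five n hn w a b c d hab hac had hbc hbd hcd
  unfold setTerms cval at h
  simp only [List.map_cons, List.map_nil, List.sum_cons, List.sum_nil, pr_pTrue] at h
  unfold pr at h
  rw [connEvent_pD1, connEvent_pD2, connEvent_pAB, connEvent_pNAB] at h
  push_cast at h
  linarith

end Summit.CriticalPhenomena.PercolationContinuityZ3.Theorems.ThreePointVarianceSet
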